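import Summits.Ventures.PercRepro.GenQFlatLatticeF

/-!
# PercRepro — the flat-lattice counting rows, part J: the pencil lemma (night-4, gen 11)

Two distinct rank-`(q − 1)` flats with `s`-point spanning traces on `G` share `≥ 2s − n` points of `G`
(`two_mul_sub_le_card_inter_of_mem_flatsTr`) and meet in a flat of rank `≤ q − 2`; if every flat of rank `≤ q − 3`
has `≤ B` points and `2s − n > B`, that flat has rank exactly `q − 2` (`inter_mem_flatsQ_of_large_traces`).  When even
`3s − 2n > B`, any two of the `s`-traces meet in the SAME rank-`(q−2)` flat `F` (three of them would otherwise meet in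
a flat of rank `≤ q − 3` with `≥ 3s − 2n` points — `three_mul_sub_le_card_inter_of_mem_flatsTr`,
`inter_eq_inter_of_large_traces`), so the traces form a pencil through `F` and their parts outside `F` are pairwise
disjoint in `G`:

`h_s · (s − f) ≤ n − f`,  `f = |F ∩ G|`   (`pencil_card_le`, for `h_s ≥ 2`)

— the row (G-P) of the two-level profile LP (sheet §65 (b)) in its structural form; the LP's numerical form
`h_s ≤ ⌊(n − f*)/(s − f*)⌋` with `f* = min(FC[q−2], s − 1)` follows from `f ≤ FC[q−2]` and `f < s`.  Imports
`GenQFlatLatticeF`.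
-/
namespace PercRepro.Night4

open Finset ThmH SixFour GenQ PerFlat Star

variable {α : Type*} [DecidableEq α] {M : Matroid α} [M.Finite]

/-- Two `s`-point spanning traces of distinct rank-`(q−1)` flats share `≥ 2s − n` points of `G`. -/
theorem two_mul_sub_le_card_inter_of_mem_flatsTr {G H H' : Finset α} {q s : ℕ} (hH : H ∈ flatsTr M G q s)
    (hH' : H' ∈ flatsTr M G q s) : 2 * s - G.card ≤ ((H ∩ H') ∩ G).card := by
  have hH1 := mem_flatsTr.1 hH
  have hH1' := mem_flatsTr.1 hH'
  have hsub : (H ∩ G) ∩ (H' ∩ G) ⊆ (H ∩ H') ∩ G := by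
    intro x hx
    simp only [Finset.mem_inter] at hx ⊢
    exact ⟨⟨hx.1.1, hx.2.1⟩, hx.1.2⟩
  have hsub2 : (H ∩ G) ∪ (H' ∩ G) ⊆ G := by
    intro x hx
    simp only [Finset.mem_union, Finset.mem_inter] at hx
    rcases hx with hx | hx
    · exact hx.2
    · exact hx.2
  have h2 := Finset.card_union_add_card_inter (H ∩ G) (H' ∩ G)
  have h3 := Finset.card_le_card hsub2
  have h4 := Finset.card_le_card hsub
  rw [hH1.2.1, hH1'.2.1] at h2
  omega

/-- **The first half of the pencil lemma (G-P)**: if every flat of rank `≤ q − 3` has `≤ B` points and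
`2s − n > B`, two distinct rank-`(q−1)` flats with `s`-point spanning traces meet in a flat of rank exactly `q − 2`. -/
theorem inter_mem_flatsQ_of_large_traces {G H H' : Finset α} {q s B : ℕ} (hq : 3 ≤ q)
    (hB : ∀ a ≤ q - 3, ∀ K ∈ flatsQ M a, K.card ≤ B) (hH : H ∈ flatsTr M G (q - 1) s)
    (hH' : H' ∈ flatsTr M G (q - 1) s) (hne : H ≠ H') (hlarge : B < 2 * s - G.card) :
    H ∩ H' ∈ flatsQ M (q - 2) := by
  have hq' : q - 2 + 1 = q - 1 := by omega
  have hHq : H ∈ flatsQ M (q - 2 + 1) := by rw [hq']; exact (mem_flatsTr.1 hH).1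
  have hHq' : H' ∈ flatsQ M (q - 2 + 1) := by rw [hq']; exact (mem_flatsTr.1 hH').1
  obtain ⟨a, hKa, har⟩ := inter_mem_flatsQ_of_ne' hHq hHq' hne
  have hpts := two_mul_sub_le_card_inter_of_mem_flatsTr hH hH'
  have hle : ((H ∩ H') ∩ G).card ≤ (H ∩ H').card := Finset.card_le_card Finset.inter_subset_left
  rcases Nat.lt_or_ge a (q - 2) with hlt | hge
  · exfalso
    have := hB a (by omega) _ hKa
    omega
  · have : a = q - 2 := by omega
    rw [this] at hKa
    exact hKa

/-- Three `s`-point spanning traces share `≥ 3s − 2n` points of `G`. -/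
theorem three_mul_sub_le_card_inter_of_mem_flatsTr {G H H' H'' : Finset α} {q s : ℕ} (hH : H ∈ flatsTr M G q s)
    (hH' : H' ∈ flatsTr M G q s) (hH'' : H'' ∈ flatsTr M G q s) :
    3 * s - 2 * G.card ≤ (((H ∩ H') ∩ H'') ∩ G).card := by
  have h2 := two_mul_sub_le_card_inter_of_mem_flatsTr hH hH'
  have hH2 := mem_flatsTr.1 hH''
  have hsub : ((H ∩ H') ∩ G) ∩ (H'' ∩ G) ⊆ ((H ∩ H') ∩ H'') ∩ G := by
    intro x hx
    simp only [Finset.mem_inter] at hx ⊢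
    exact ⟨⟨hx.1.1, hx.2.1⟩, hx.1.2⟩
  have hsub2 : ((H ∩ H') ∩ G) ∪ (H'' ∩ G) ⊆ G := by
    intro x hx
    simp only [Finset.mem_union, Finset.mem_inter] at hx
    rcases hx with hx | hx
    · exact hx.2
    · exact hx.2
  have h3 := Finset.card_union_add_card_inter ((H ∩ H') ∩ G) (H'' ∩ G)
  have h4 := Finset.card_le_card hsub2
  have h5 := Finset.card_le_card hsub
  rw [hH2.2.1] at h3
  omega

/-- Under `3s − 2n > B`, two distinct `s`-traces through a third one meet it in the same flat:
`H ∩ H₁ = H′ ∩ H₁` for `H, H′ ≠ H₁`. -/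
theorem inter_eq_inter_of_large_traces {G H H' H₁ : Finset α} {q s B : ℕ} (hq : 3 ≤ q)
    (hB : ∀ a ≤ q - 3, ∀ K ∈ flatsQ M a, K.card ≤ B) (hH : H ∈ flatsTr M G (q - 1) s)
    (hH' : H' ∈ flatsTr M G (q - 1) s) (hH₁ : H₁ ∈ flatsTr M G (q - 1) s) (hne : H ≠ H₁) (hne' : H' ≠ H₁)
    (hlarge : B < 3 * s - 2 * G.card) : H ∩ H₁ = H' ∩ H₁ := by
  have hsn : s ≤ G.card := by
    rw [← (mem_flatsTr.1 hH).2.1]; exact Finset.card_le_card Finset.inter_subset_right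
  have hlarge2 : B < 2 * s - G.card := by omega
  have hF := inter_mem_flatsQ_of_large_traces hq hB hH hH₁ hne hlarge2
  have hF' := inter_mem_flatsQ_of_large_traces hq hB hH' hH₁ hne' hlarge2
  by_contra hneq
  have hq' : q - 3 + 1 = q - 2 := by omega
  have hFq : H ∩ H₁ ∈ flatsQ M (q - 3 + 1) := by rw [hq']; exact hF
  have hFq' : H' ∩ H₁ ∈ flatsQ M (q - 3 + 1) := by rw [hq']; exact hF'
  obtain ⟨a, hKa, har⟩ := inter_mem_flatsQ_of_ne' hFq hFq' hneq
  have hsmall := hB a har _ hKa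
  have h3 := three_mul_sub_le_card_inter_of_mem_flatsTr hH hH' hH₁
  have hsub : ((H ∩ H') ∩ H₁) ∩ G ⊆ (H ∩ H₁) ∩ (H' ∩ H₁) := by
    intro x hx
    simp only [Finset.mem_inter] at hx ⊢
    exact ⟨⟨hx.1.1.1, hx.1.2⟩, hx.1.1.2, hx.1.2⟩
  have := Finset.card_le_card hsub
  omega

/-- **The pencil lemma (G-P)**: with `h_s ≥ 2` traces and `3s − 2n > B`, there is a rank-`(q−2)` flat `F` inside every
`s`-trace with `h_s · (s − |F ∩ G|) ≤ n − |F ∩ G|`. -/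
theorem pencil_card_le {G : Finset α} {q s B : ℕ} (hq : 3 ≤ q) (hB : ∀ a ≤ q - 3, ∀ K ∈ flatsQ M a, K.card ≤ B)
    (hlarge : B < 3 * s - 2 * G.card) (hh : 2 ≤ hypTr M G (q - 1) s) :
    ∃ F ∈ flatsQ M (q - 2), (∀ H ∈ flatsTr M G (q - 1) s, F ⊆ H) ∧
      hypTr M G (q - 1) s * (s - (F ∩ G).card) ≤ G.card - (F ∩ G).card := by
  classical
  unfold hypTr at hh ⊢
  obtain ⟨H₁, hH₁, H₂, hH₂, hne12⟩ := Finset.one_lt_card.1 hh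
  have hsn : s ≤ G.card := by
    rw [← (mem_flatsTr.1 hH₁).2.1]; exact Finset.card_le_card Finset.inter_subset_right
  have hlarge2 : B < 2 * s - G.card := by omega
  -- every trace other than `H₁` meets `H₁` in `F := H₂ ∩ H₁`
  set F := H₂ ∩ H₁ with hFdef
  have hF : F ∈ flatsQ M (q - 2) := inter_mem_flatsQ_of_large_traces hq hB hH₂ hH₁ (Ne.symm hne12) hlarge2
  have hmeet1 : ∀ H ∈ flatsTr M G (q - 1) s, H ≠ H₁ → H ∩ H₁ = F := fun H hH hne =>
    inter_eq_inter_of_large_traces hq hB hH hH₂ hH₁ hne (Ne.symm hne12) hlarge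
  -- hence any two distinct traces meet in `F`
  have hmeet : ∀ H ∈ flatsTr M G (q - 1) s, ∀ H' ∈ flatsTr M G (q - 1) s, H ≠ H' → H ∩ H' = F := by
    intro H hH H' hH' hne
    by_cases h1 : H = H₁
    · subst h1
      rw [Finset.inter_comm]; exact hmeet1 H' hH' (Ne.symm hne)
    by_cases h1' : H' = H₁
    · subst h1'; exact hmeet1 H hH hne
    · -- `H ∩ H₁ = F = H′ ∩ H₁`; `H ∩ H′` meets `H₁` in `F` too
      have hA := hmeet1 H hH h1
      have hA' := hmeet1 H' hH' h1'
      have hHH' := inter_mem_flatsQ_of_large_traces hq hB hH hH' hne hlarge2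
      by_contra hneq
      have hq' : q - 3 + 1 = q - 2 := by omega
      have hFq : H ∩ H' ∈ flatsQ M (q - 3 + 1) := by rw [hq']; exact hHH'
      have hFq' : F ∈ flatsQ M (q - 3 + 1) := by rw [hq']; exact hF
      obtain ⟨a, hKa, har⟩ := inter_mem_flatsQ_of_ne' hFq hFq' hneq
      have hsmall := hB a har _ hKa
      have h3 := three_mul_sub_le_card_inter_of_mem_flatsTr hH hH' hH₁
      have hsub : ((H ∩ H') ∩ H₁) ∩ G ⊆ (H ∩ H') ∩ F := by
        intro x hx
        simp only [Finset.mem_inter] at hx ⊢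
        refine ⟨⟨hx.1.1.1, hx.1.1.2⟩, ?_⟩
        rw [← hA]
        simp only [Finset.mem_inter]
        exact ⟨hx.1.1.1, hx.1.2⟩
      have := Finset.card_le_card hsub
      omega
  have hFsub : ∀ H ∈ flatsTr M G (q - 1) s, F ⊆ H := by
    intro H hH
    by_cases h1 : H = H₁
    · subst h1; exact Finset.inter_subset_right
    · rw [← hmeet1 H hH h1]; exact Finset.inter_subset_left
  refine ⟨F, hF, hFsub, ?_⟩
  -- the parts outside `F` are pairwise disjoint in `G ∖ F`
  have hdisj : (flatsTr M G (q - 1) s : Set (Finset α)).PairwiseDisjoint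
      (fun H : Finset α => (H ∩ G) \ F) := by
    intro H hH H' hH' hne
    rw [Function.onFun, Finset.disjoint_left]
    intro x hx hx'
    rw [Finset.mem_sdiff, Finset.mem_inter] at hx hx'
    have hmem : x ∈ H ∩ H' := Finset.mem_inter.2 ⟨hx.1.1, hx'.1.1⟩
    rw [hmeet H hH H' hH' hne] at hmem
    exact hx.2 hmem
  have hcard : ∀ H ∈ flatsTr M G (q - 1) s, ((H ∩ G) \ F).card = s - (F ∩ G).card := by
    intro H hH
    have hFG : F ∩ G ⊆ H ∩ G := Finset.inter_subset_inter (hFsub H hH) (Finset.Subset.refl G)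
    have h1 : (H ∩ G) \ F = (H ∩ G) \ (F ∩ G) := by
      ext x
      simp only [Finset.mem_sdiff, Finset.mem_inter]
      tauto
    rw [h1, Finset.card_sdiff, Finset.inter_eq_left.2 hFG, (mem_flatsTr.1 hH).2.1]
  have hunion : (flatsTr M G (q - 1) s).biUnion (fun H : Finset α => (H ∩ G) \ F) ⊆ G \ (F ∩ G) := by
    intro x hx
    rw [Finset.mem_biUnion] at hx
    obtain ⟨H, _, hx⟩ := hx
    rw [Finset.mem_sdiff, Finset.mem_inter] at hx
    rw [Finset.mem_sdiff, Finset.mem_inter]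
    exact ⟨hx.1.2, fun h => hx.2 h.1⟩
  have h1 := Finset.card_le_card hunion
  rw [Finset.card_biUnion hdisj, Finset.sum_congr rfl hcard, Finset.sum_const, smul_eq_mul] at h1
  have h2 : (G \ (F ∩ G)).card = G.card - (F ∩ G).card := by
    rw [Finset.card_sdiff, Finset.inter_eq_left.2 Finset.inter_subset_right]
  rw [h2] at h1
  exact h1

end PercRepro.Night4
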